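import Mathlib
import HarnessLib
import Literature.Analysis.ODE.AnalyticFlowDomain
import Summits.NavierStokesRegularity.NavierStokesRegularity.Theorems.PoloidalWindowDoorLrcModEntireTwistingTHLocalGalilean

/-!
# Route `PoloidalWindowDoor`, item `LrcModEntire` (stmt-20428) / crux `PoloidalWindowRigidity` (stmt-19708) —
# the registered local (TH)∩twisting statement MAY ASSUME A CO-MOVING REST WORLDLINE `u(t, x₀) = 0` for all `t` near `t₀`

Cell ns-regularity-ideate, seat ns-k2-port-2 g2 (kernel-port lineage under the LEAD of item 20428, ns-poloidal-K2-p3 g11; `--supports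
stmt-NavierStokesRegularity-20428`).  Companion of `…TwistingTHLocalGalilean` (K2-p2 g7: constant boost ⇒ `u(p₀) = 0`).  The LEAD's DYNAMIC (tangency) rows
(`Cruxes/LrcModEntire/DYNAMIC-ROWS-g11.md` §2) live in the CO-MOVING frame `x′ = x − X(t)`, `Ẋ = u(t, X(t))`, `X(t₀) = x₀`, where `u′(t, x₀) ≡ 0` for ALL `t`
near `t₀` (frame row `G0` and its time derivatives).  This file proves that normalisation sound for the REGISTERED statement `stub_localTHEmptyHypNUGRS`
(twist_split v4.3/v5): the system {`∂₀u₁ = ∂₁u₀`, `div u = 0`, `∂₂u_b = μ(t,z)∂_bu₂`, E} is covariant under the TIME-DEPENDENT translation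
`τ(t,y) = (t, y + c(t))` by an analytic path `c`, `c(t₀) = 0`:  `u′(t,y) = u(t, y + c(t)) − ċ(t)`, `μ′(t,z) = μ(t, z + c₂(t))`,
`A′ = A + ċ₂(∂ₜμ − ∂_z²μ) + (ċ₂²/2)∂_zμ − (1 − μ)c̈₂` (at `(t, z + c₂(t))`; `c₂` = vertical component) — the frame acceleration `−c̈`, like the slope corrections,
depends on `(t,z)` only and is absorbed into the pressure datum.  With `c = X − x₀` for the ANALYTIC particle path `X` (Cauchy–Lipschitz with analytic dependence,
`Literature.Analysis.ODE.exists_analyticOnNhd_flow_timeDependent`, Lang 1995 IV §1, proved in the tree) the boosted field has `u′(t, x₀) = u(t,X(t)) − Ẋ(t) = 0` for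
`t` near `t₀`, while every jet entering the pins at `p₀` is unchanged (`c(t₀) = 0`, `ċ(t₀) = u(p₀) = 0`).

* `fderiv_tboost`, `fderiv_fderiv_tboost`, `fderiv_tboost_vert`, `laplacian_tboost_vert`, `deriv_tboost_vert`, `deriv_tboostSlope_time` — jets of the boosted datum;
* `comoving_E` — E is covariant under time-dependent translations (one computation, `linear_combination`);
* `localTHEmptyHypNUGRS_of_comoving` — **the registered v4.3/v5 statement ⇐ the same statement with ONE MORE hypothesis `∀ᶠ s in 𝓝 p₀.1, u s p₀.2 = 0`.**
  The kernel side turns the worldline into point-ZERO letters for all time jets `∂ₜ^τ u_i(p₀)` (the LEAD's `G0, D(G0), D²(G0)`), so co-moving certificates check by name.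

WHAT THIS IS NOT: not a proof of the stub and not a claim about Navier–Stokes — a free normalisation of the registered local statement (extended Galilean
invariance; bears_on LADDER-NS N0 via item 20428 / crux 19708). [folklore]
-/

noncomputable section

-- the summit and its single sub-problem share the name (CONVENTIONS §1), as in every Theorems file
set_option linter.dupNamespace false

namespace Summit.NavierStokesRegularity.NavierStokesRegularity.Theorems.PoloidalWindowDoorLrcModEntireTwistingTHLocalComoving

open Set Function Filter Topology Metric
open scoped RealInnerProductSpace InnerProductSpace Laplacian
open Literature.Analysis Literature.Analysis.FluidPDE
open Summit.NavierStokesRegularity.NavierStokesRegularity.Theorems.PoloidalWindowDoorLrcModEntireJetLetters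
open Summit.NavierStokesRegularity.NavierStokesRegularity.Theorems.PoloidalWindowDoorLrcModEntireTHCertLetters
open Summit.NavierStokesRegularity.NavierStokesRegularity.Theorems.PoloidalWindowDoorLrcModEntireTHCertDictionary
open Summit.NavierStokesRegularity.NavierStokesRegularity.Theorems.PoloidalWindowDoorPoloidalWindowRigiditySlopeFunctionSource
open Summit.NavierStokesRegularity.NavierStokesRegularity.Theorems.PoloidalWindowDoorLrcModEntireTwistingTHLocalGalilean

variable {u : ℝ → EuclideanSpace ℝ (Fin 3) → EuclideanSpace ℝ (Fin 3)} {μ : ℝ → ℝ → ℝ}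
  {U : Set (ℝ × EuclideanSpace ℝ (Fin 3))}

/-- First spatial derivatives of the boosted field are the translated ones. [folklore] -/
theorem fderiv_tboost (u : ℝ → EuclideanSpace ℝ (Fin 3) → EuclideanSpace ℝ (Fin 3)) (c : ℝ → EuclideanSpace ℝ (Fin 3)) (t : ℝ)
    (y : EuclideanSpace ℝ (Fin 3)) :
    fderiv ℝ (fun z => u t (z + c t) - deriv c t) y = fderiv ℝ (u t) (y + c t) :=
  fderiv_comp_add_right_sub_const (u t) (c t) (deriv c t) y

/-- Second spatial derivatives of the vertical component of the boosted field are the translated ones. [folklore] -/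
theorem fderiv_fderiv_tboost (u : ℝ → EuclideanSpace ℝ (Fin 3) → EuclideanSpace ℝ (Fin 3)) (c : ℝ → EuclideanSpace ℝ (Fin 3)) (t : ℝ)
    (y e : EuclideanSpace ℝ (Fin 3)) :
    fderiv ℝ (fun z => fderiv ℝ (fun z' => u t (z' + c t) - deriv c t) z e 2) y =
      fderiv ℝ (fun z => fderiv ℝ (u t) z e 2) (y + c t) := by
  have h : (fun z => fderiv ℝ (fun z' => u t (z' + c t) - deriv c t) z e 2) =
      fun z => (fun w => fderiv ℝ (u t) w e 2) (z + c t) := by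
    funext z; rw [fderiv_tboost]
  rw [h, fderiv_comp_add_right (f := fun w => fderiv ℝ (u t) w e 2) (c t)]

/-- The vertical component of the boosted field is a translate of `u₂ − ċ₂`. [folklore] -/
theorem tboost_vert_eq (u : ℝ → EuclideanSpace ℝ (Fin 3) → EuclideanSpace ℝ (Fin 3)) (c : ℝ → EuclideanSpace ℝ (Fin 3)) (t : ℝ) :
    (fun z => (u t (z + c t) - deriv c t) 2) = fun z => (fun w => u t w 2 - deriv c t 2) (z + c t) := by
  funext z; simp

/-- The horizontal derivative of the vertical component of the boosted field. [folklore] -/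
theorem fderiv_tboost_vert (u : ℝ → EuclideanSpace ℝ (Fin 3) → EuclideanSpace ℝ (Fin 3)) (c : ℝ → EuclideanSpace ℝ (Fin 3)) (t : ℝ)
    (y : EuclideanSpace ℝ (Fin 3)) :
    fderiv ℝ (fun z => (u t (z + c t) - deriv c t) 2) y = fderiv ℝ (fun w => u t w 2) (y + c t) := by
  rw [tboost_vert_eq, fderiv_comp_add_right (f := fun w => u t w 2 - deriv c t 2) (c t), fderiv_sub_const]

/-- The Laplacian of the vertical component of the boosted field (where the slice is `C²`). [folklore] -/
theorem laplacian_tboost_vert (u : ℝ → EuclideanSpace ℝ (Fin 3) → EuclideanSpace ℝ (Fin 3)) (c : ℝ → EuclideanSpace ℝ (Fin 3)) (t : ℝ)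
    (y : EuclideanSpace ℝ (Fin 3)) (h2 : ContDiffAt ℝ 2 (fun w => u t w 2) (y + c t)) :
    Δ (fun z => (u t (z + c t) - deriv c t) 2) y = Δ (fun w => u t w 2) (y + c t) := by
  rw [tboost_vert_eq, laplacian_comp_add_right (fun w => u t w 2 - deriv c t 2) (c t) y]
  have e : (fun w => u t w 2 - deriv c t 2) = (fun w => u t w 2) - fun _ => deriv c t 2 := rfl
  rw [e, h2.laplacian_sub contDiffAt_const]
  simp

/-- The time derivative of the vertical component of the boosted field at fixed `y`: the material correction `Du₂·ċ` and the frame acceleration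
`−c̈₂` appear (chain rule through the analytic space–time field; `c` twice differentiable at `t`). [folklore] -/
theorem deriv_tboost_vert (hu : AnalyticOnNhd ℝ (uncurry u) U) (c : ℝ → EuclideanSpace ℝ (Fin 3)) {t : ℝ}
    (hc : DifferentiableAt ℝ c t) (hdc : DifferentiableAt ℝ (deriv c) t)
    {y : EuclideanSpace ℝ (Fin 3)} (hq : ((t, y + c t) : ℝ × EuclideanSpace ℝ (Fin 3)) ∈ U) :
    deriv (fun s => (u s (y + c s) - deriv c s) 2) t =
      deriv (fun s => u s (y + c t) 2) t + fderiv ℝ (fun w => u t w 2) (y + c t) (deriv c t) - deriv (deriv c) t 2 := by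
  set σ : EuclideanSpace ℝ (Fin 3) := y + c t with hσ
  have hF : AnalyticAt ℝ (fun q : ℝ × EuclideanSpace ℝ (Fin 3) => u q.1 q.2 2) (t, σ) := analyticOnNhd_comp hu 2 _ hq
  have hγ : HasDerivAt (fun s : ℝ => ((s, y + c s) : ℝ × EuclideanSpace ℝ (Fin 3))) (((1 : ℝ), deriv c t)) t :=
    (hasDerivAt_id t).prodMk (hc.hasDerivAt.const_add y)
  have hacc : HasDerivAt (fun s => deriv c s 2) (deriv (deriv c) t 2) t :=
    (EuclideanSpace.proj (2 : Fin 3) : EuclideanSpace ℝ (Fin 3) →L[ℝ] ℝ).hasFDerivAt.comp_hasDerivAt t hdc.hasDerivAt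
  have hcomp : HasDerivAt (fun s => (u s (y + c s) - deriv c s) 2)
      (fderiv ℝ (fun q : ℝ × EuclideanSpace ℝ (Fin 3) => u q.1 q.2 2) (t, σ) ((1 : ℝ), deriv c t) - deriv (deriv c) t 2) t := by
    have h := (hF.differentiableAt.hasFDerivAt.comp_hasDerivAt t (by simpa [hσ] using hγ)).sub hacc
    exact h.congr_of_eventuallyEq (Eventually.of_forall fun s => by simp)
  have hsplit : (((1 : ℝ), deriv c t) : ℝ × EuclideanSpace ℝ (Fin 3)) =
      ((1 : ℝ), (0 : EuclideanSpace ℝ (Fin 3))) + ((0 : ℝ), deriv c t) := by simp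
  have e1 : fderiv ℝ (fun q : ℝ × EuclideanSpace ℝ (Fin 3) => u q.1 q.2 2) (t, σ) ((1 : ℝ), (0 : EuclideanSpace ℝ (Fin 3))) =
      deriv (fun s => u s σ 2) t := (deriv_spacetime_time (p := (t, σ)) hF.differentiableAt).symm
  have e2 : fderiv ℝ (fun q : ℝ × EuclideanSpace ℝ (Fin 3) => u q.1 q.2 2) (t, σ) ((0 : ℝ), deriv c t) =
      fderiv ℝ (fun w => u t w 2) σ (deriv c t) := fderiv_spacetime_spatial (p := (t, σ)) hF.differentiableAt (deriv c t)
  rw [hcomp.deriv, hsplit, map_add, e1, e2]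

/-- `∂ₜ μ′(t,z) = ∂ₜμ + ċ₂ ∂_zμ` at `(t, z + c₂(t))` (chain rule through the analytic slope). [folklore] -/
theorem deriv_tboostSlope_time (μ : ℝ → ℝ → ℝ) (c : ℝ → EuclideanSpace ℝ (Fin 3)) {t z : ℝ} (hc : DifferentiableAt ℝ c t)
    (hμ : DifferentiableAt ℝ (uncurry μ) (t, z + c t 2)) :
    deriv (fun s => μ s (z + c s 2)) t =
      deriv (fun s => μ s (z + c t 2)) t + deriv c t 2 * deriv (μ t) (z + c t 2) := by
  set ζ : ℝ := z + c t 2 with hζ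
  have hc2 : HasDerivAt (fun s => c s 2) (deriv c t 2) t :=
    (EuclideanSpace.proj (2 : Fin 3) : EuclideanSpace ℝ (Fin 3) →L[ℝ] ℝ).hasFDerivAt.comp_hasDerivAt t hc.hasDerivAt
  have hγ : HasDerivAt (fun s : ℝ => ((s, z + c s 2) : ℝ × ℝ)) (((1 : ℝ), deriv c t 2)) t :=
    (hasDerivAt_id t).prodMk (hc2.const_add z)
  have hcomp : HasDerivAt (fun s => μ s (z + c s 2)) (fderiv ℝ (uncurry μ) (t, ζ) ((1 : ℝ), deriv c t 2)) t := by
    have h := hμ.hasFDerivAt.comp_hasDerivAt t (by simpa [hζ] using hγ)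
    exact h.congr_of_eventuallyEq (Eventually.of_forall fun s => by simp)
  have hsplit : (((1 : ℝ), deriv c t 2) : ℝ × ℝ) = ((1 : ℝ), (0 : ℝ)) + (deriv c t 2) • ((0 : ℝ), (1 : ℝ)) := by simp
  obtain ⟨hz, ht⟩ := hasDerivAt_slices_of_uncurry (p := (t, ζ)) hμ
  rw [hcomp.deriv, hsplit, map_add, map_smul, ← ht.deriv, ← hz.deriv, smul_eq_mul]

/-- **E is covariant under time-dependent translations.**  At a point `(t, y)` whose translate `q = (t, y + c(t))` lies in `U`, the scalar law E of the
boosted datum `(u′, μ′, A′)` at `(t, y)` IS the law E of `(u, μ, A)` at `q`; the frame acceleration enters `A′` as `−(1−μ)c̈₂`. [folklore] -/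
theorem comoving_E (hu : AnalyticOnNhd ℝ (uncurry u) U) (hμ : ∀ p ∈ U, AnalyticAt ℝ (uncurry μ) (p.1, p.2 2))
    {A : ℝ → ℝ → ℝ} (c : ℝ → EuclideanSpace ℝ (Fin 3)) {t : ℝ} (hc : DifferentiableAt ℝ c t) (hdc : DifferentiableAt ℝ (deriv c) t)
    {y : EuclideanSpace ℝ (Fin 3)} (hq : ((t, y + c t) : ℝ × EuclideanSpace ℝ (Fin 3)) ∈ U)
    (hE : (1 - μ t ((y + c t) 2)) *
        (deriv (fun s => u s (y + c t) 2) t +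
            fderiv ℝ (fun w => u t w 2) (y + c t) (u t (y + c t)) -
          Δ (fun w => u t w 2) (y + c t)) =
      A t ((y + c t) 2) +
          (deriv (fun s => μ s ((y + c t) 2)) t - deriv (deriv (μ t)) ((y + c t) 2)) * u t (y + c t) 2 +
        deriv (μ t) ((y + c t) 2) / 2 * u t (y + c t) 2 ^ 2 -
      2 * deriv (μ t) ((y + c t) 2) * fderiv ℝ (u t) (y + c t) (EuclideanSpace.single 2 1) 2) :
    (1 - μ t (y 2 + c t 2)) *
        (deriv (fun s => (u s (y + c s) - deriv c s) 2) t +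
            fderiv ℝ (fun z => (u t (z + c t) - deriv c t) 2) y (u t (y + c t) - deriv c t) -
          Δ (fun z => (u t (z + c t) - deriv c t) 2) y) =
      (A t (y 2 + c t 2) +
            deriv c t 2 * (deriv (fun s => μ s (y 2 + c t 2)) t - deriv (deriv (μ t)) (y 2 + c t 2)) +
          deriv c t 2 ^ 2 / 2 * deriv (μ t) (y 2 + c t 2) - (1 - μ t (y 2 + c t 2)) * deriv (deriv c) t 2) +
          (deriv (fun s => μ s (y 2 + c s 2)) t -
              deriv (deriv (fun ζ => μ t (ζ + c t 2))) (y 2)) *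
            (u t (y + c t) - deriv c t) 2 +
        deriv (fun ζ => μ t (ζ + c t 2)) (y 2) / 2 * (u t (y + c t) - deriv c t) 2 ^ 2 -
      2 * deriv (fun ζ => μ t (ζ + c t 2)) (y 2) *
        fderiv ℝ (fun z => u t (z + c t) - deriv c t) y (EuclideanSpace.single 2 1) 2 := by
  set σ : EuclideanSpace ℝ (Fin 3) := y + c t with hσ
  have hσ2 : σ 2 = y 2 + c t 2 := by rw [hσ]; simp
  have hF2 : ContDiffAt ℝ 2 (fun w => u t w 2) σ := by
    have h := (analyticOnNhd_comp hu 2 _ hq)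
    have h' : AnalyticAt ℝ (fun w => u t w 2) σ := by
      have hcmp := h.comp (analyticAt_const.prod analyticAt_id : AnalyticAt ℝ (fun w : EuclideanSpace ℝ (Fin 3) =>
        ((t, w) : ℝ × EuclideanSpace ℝ (Fin 3))) σ)
      simpa [Function.comp_def] using hcmp
    exact h'.contDiffAt
  have hμd : DifferentiableAt ℝ (uncurry μ) (t, y 2 + c t 2) := by
    rw [← hσ2]; exact (hμ _ hq).differentiableAt
  rw [deriv_tboost_vert hu c hc hdc hq, fderiv_tboost_vert, laplacian_tboost_vert u c t y hF2, fderiv_tboost,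
    deriv_comp_add_const (μ t) (c t 2) (y 2)]
  have hzz : deriv (deriv (fun ζ => μ t (ζ + c t 2))) (y 2) = deriv (deriv (μ t)) (y 2 + c t 2) := by
    have h : deriv (fun ζ => μ t (ζ + c t 2)) = fun ζ => deriv (μ t) (ζ + c t 2) := by
      funext ζ; exact deriv_comp_add_const (μ t) (c t 2) ζ
    rw [h, deriv_comp_add_const (deriv (μ t)) (c t 2) (y 2)]
  rw [hzz, deriv_tboostSlope_time μ c hc hμd, ← hσ2]
  have hlin : fderiv ℝ (fun w => u t w 2) σ (u t σ - deriv c t) = fderiv ℝ (fun w => u t w 2) σ (u t σ) -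
      fderiv ℝ (fun w => u t w 2) σ (deriv c t) := map_sub _ _ _
  have hv : (u t σ - deriv c t) 2 = u t σ 2 - deriv c t 2 := by simp
  rw [hlin, hv]
  linear_combination hE

/-- **The registered local (TH)∩twisting statement `stub_localTHEmptyHypNUGRS` (twist_split v4.3/v5, verbatim conclusion) may ALSO assume the
co-moving rest worldline `u(s, x₀) = 0` for all `s` near `t₀`.**  Boost by the analytic particle path `X` through `x₀` (`Ẋ = u(t,X)`, `X(t₀) = x₀`;
`Literature.Analysis.ODE.exists_analyticOnNhd_flow_timeDependent`): `c = X − x₀`, `u′(t,y) = u(t, y + c(t)) − ċ(t)`; at `t = t₀` nothing changes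
(`c(t₀) = 0`, `ċ(t₀) = u(p₀) = 0`), so all pins, the Galilean rest point and the RS normal form are kept. [folklore] -/
theorem localTHEmptyHypNUGRS_of_comoving
    (hC : ∀ (u : ℝ → EuclideanSpace ℝ (Fin 3) → EuclideanSpace ℝ (Fin 3)) (μ A : ℝ → ℝ → ℝ)
      (U : Set (ℝ × EuclideanSpace ℝ (Fin 3))) (p₀ : ℝ × EuclideanSpace ℝ (Fin 3)),
      IsOpen U → p₀ ∈ U → AnalyticOnNhd ℝ (Function.uncurry u) U →
      (∀ p ∈ U, AnalyticAt ℝ (Function.uncurry μ) (p.1, p.2 2)) → (∀ p ∈ U, AnalyticAt ℝ (Function.uncurry A) (p.1, p.2 2)) →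
      (∀ p ∈ U, fderiv ℝ (u p.1) p.2 (EuclideanSpace.single 0 1) 1 = fderiv ℝ (u p.1) p.2 (EuclideanSpace.single 1 1) 0) →
      (∀ p ∈ U, fderiv ℝ (u p.1) p.2 (EuclideanSpace.single 0 1) 0 + fderiv ℝ (u p.1) p.2 (EuclideanSpace.single 1 1) 1 +
        fderiv ℝ (u p.1) p.2 (EuclideanSpace.single 2 1) 2 = 0) →
      (∀ p ∈ U, ∀ b : Fin 3, b ≠ 2 →
        fderiv ℝ (u p.1) p.2 (EuclideanSpace.single 2 1) b = μ p.1 (p.2 2) * fderiv ℝ (u p.1) p.2 (EuclideanSpace.single b 1) 2) →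
      (∀ p ∈ U,
        (1 - μ p.1 (p.2 2)) *
            (deriv (fun s => u s p.2 2) p.1 + fderiv ℝ (fun y => u p.1 y 2) p.2 (u p.1 p.2)
              - Δ (fun y => u p.1 y 2) p.2) =
          A p.1 (p.2 2) + (deriv (fun s => μ s (p.2 2)) p.1 - deriv (deriv (μ p.1)) (p.2 2)) * u p.1 p.2 2
            + deriv (μ p.1) (p.2 2) / 2 * u p.1 p.2 2 ^ 2 - 2 * deriv (μ p.1) (p.2 2) * fderiv ℝ (u p.1) p.2 (EuclideanSpace.single 2 1) 2) →
      fderiv ℝ (fun y => fderiv ℝ (u p₀.1) y (EuclideanSpace.single 2 1) 2) p₀.2 (EuclideanSpace.single 0 1) *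
            fderiv ℝ (u p₀.1) p₀.2 (EuclideanSpace.single 1 1) 2 -
          fderiv ℝ (fun y => fderiv ℝ (u p₀.1) y (EuclideanSpace.single 2 1) 2) p₀.2 (EuclideanSpace.single 1 1) *
            fderiv ℝ (u p₀.1) p₀.2 (EuclideanSpace.single 0 1) 2 ≠ 0 →
      μ p₀.1 (p₀.2 2) ≠ 0 → μ p₀.1 (p₀.2 2) ≠ 1 → deriv (μ p₀.1) (p₀.2 2) ≠ 0 → μ p₀.1 (p₀.2 2) < 0 →
      (fderiv ℝ (u p₀.1) p₀.2 (EuclideanSpace.single 0 1) 0 ≠ fderiv ℝ (u p₀.1) p₀.2 (EuclideanSpace.single 1 1) 1 ∨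
        fderiv ℝ (u p₀.1) p₀.2 (EuclideanSpace.single 1 1) 0 ≠ 0) →
      u p₀.1 p₀.2 = 0 → fderiv ℝ (u p₀.1) p₀.2 (EuclideanSpace.single 0 1) 2 = 0 → fderiv ℝ (u p₀.1) p₀.2 (EuclideanSpace.single 1 1) 2 = 1 →
      (∀ᶠ s in 𝓝 p₀.1, u s p₀.2 = 0) → False) :
    ∀ (u : ℝ → EuclideanSpace ℝ (Fin 3) → EuclideanSpace ℝ (Fin 3)) (μ A : ℝ → ℝ → ℝ)
      (U : Set (ℝ × EuclideanSpace ℝ (Fin 3))) (p₀ : ℝ × EuclideanSpace ℝ (Fin 3)),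
      IsOpen U → p₀ ∈ U → AnalyticOnNhd ℝ (Function.uncurry u) U →
      (∀ p ∈ U, AnalyticAt ℝ (Function.uncurry μ) (p.1, p.2 2)) → (∀ p ∈ U, AnalyticAt ℝ (Function.uncurry A) (p.1, p.2 2)) →
      (∀ p ∈ U, fderiv ℝ (u p.1) p.2 (EuclideanSpace.single 0 1) 1 = fderiv ℝ (u p.1) p.2 (EuclideanSpace.single 1 1) 0) →
      (∀ p ∈ U, fderiv ℝ (u p.1) p.2 (EuclideanSpace.single 0 1) 0 + fderiv ℝ (u p.1) p.2 (EuclideanSpace.single 1 1) 1 +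
        fderiv ℝ (u p.1) p.2 (EuclideanSpace.single 2 1) 2 = 0) →
      (∀ p ∈ U, ∀ b : Fin 3, b ≠ 2 →
        fderiv ℝ (u p.1) p.2 (EuclideanSpace.single 2 1) b = μ p.1 (p.2 2) * fderiv ℝ (u p.1) p.2 (EuclideanSpace.single b 1) 2) →
      (∀ p ∈ U,
        (1 - μ p.1 (p.2 2)) *
            (deriv (fun s => u s p.2 2) p.1 + fderiv ℝ (fun y => u p.1 y 2) p.2 (u p.1 p.2)
              - Δ (fun y => u p.1 y 2) p.2) =
          A p.1 (p.2 2) + (deriv (fun s => μ s (p.2 2)) p.1 - deriv (deriv (μ p.1)) (p.2 2)) * u p.1 p.2 2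
            + deriv (μ p.1) (p.2 2) / 2 * u p.1 p.2 2 ^ 2 - 2 * deriv (μ p.1) (p.2 2) * fderiv ℝ (u p.1) p.2 (EuclideanSpace.single 2 1) 2) →
      fderiv ℝ (fun y => fderiv ℝ (u p₀.1) y (EuclideanSpace.single 2 1) 2) p₀.2 (EuclideanSpace.single 0 1) *
            fderiv ℝ (u p₀.1) p₀.2 (EuclideanSpace.single 1 1) 2 -
          fderiv ℝ (fun y => fderiv ℝ (u p₀.1) y (EuclideanSpace.single 2 1) 2) p₀.2 (EuclideanSpace.single 1 1) *
            fderiv ℝ (u p₀.1) p₀.2 (EuclideanSpace.single 0 1) 2 ≠ 0 →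
      μ p₀.1 (p₀.2 2) ≠ 0 → μ p₀.1 (p₀.2 2) ≠ 1 → deriv (μ p₀.1) (p₀.2 2) ≠ 0 → μ p₀.1 (p₀.2 2) < 0 →
      (fderiv ℝ (u p₀.1) p₀.2 (EuclideanSpace.single 0 1) 0 ≠ fderiv ℝ (u p₀.1) p₀.2 (EuclideanSpace.single 1 1) 1 ∨
        fderiv ℝ (u p₀.1) p₀.2 (EuclideanSpace.single 1 1) 0 ≠ 0) →
      u p₀.1 p₀.2 = 0 →
      fderiv ℝ (u p₀.1) p₀.2 (EuclideanSpace.single 0 1) 2 = 0 →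
      fderiv ℝ (u p₀.1) p₀.2 (EuclideanSpace.single 1 1) 2 = 1 → False := by
  intro u μ A U p₀ hU hp₀ hu hμ hA hpol hdiv hsh hE htw hm0 hm1 hmz hneg hNU hrest hx0 hy1
  obtain ⟨t₀, x₀⟩ := p₀
  -- the analytic particle path through `x₀`
  obtain ⟨Φ, r, hr, ε, hε, hΦ0, hΦd, hΦa⟩ :=
    Literature.Analysis.ODE.exists_analyticOnNhd_flow_timeDependent (F := uncurry u) hU hu (t₀ := t₀) (x₀ := x₀) hp₀
  set I : Set ℝ := Ioo (t₀ - ε) (t₀ + ε) with hI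
  have hIo : IsOpen I := isOpen_Ioo; have ht₀I : t₀ ∈ I := by rw [hI]; exact ⟨by linarith, by linarith⟩
  have hx₀b : x₀ ∈ ball x₀ r := mem_ball_self hr
  set c : ℝ → EuclideanSpace ℝ (Fin 3) := fun s => Φ x₀ s - x₀ with hc
  have hc₀ : c t₀ = 0 := by simp [hc, hΦ0 x₀ hx₀b]
  -- `X = Φ x₀` is analytic on `I`, hence so are `c`, `ċ`, `c̈`
  have hXa : ∀ s ∈ I, AnalyticAt ℝ (Φ x₀) s := by
    intro s hs
    have h := (hΦa (x₀, s) ⟨hx₀b, hs⟩).comp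
      ((analyticAt_const (v := x₀)).prod analyticAt_id : AnalyticAt ℝ (fun s : ℝ => ((x₀, s) : EuclideanSpace ℝ (Fin 3) × ℝ)) s)
    simpa [Function.comp_def] using h
  have hca : ∀ s ∈ I, AnalyticAt ℝ c s := fun s hs => (hXa s hs).sub analyticAt_const
  have hdca : ∀ s ∈ I, AnalyticAt ℝ (deriv c) s := fun s hs => (hca s hs).deriv
  have hddca : ∀ s ∈ I, AnalyticAt ℝ (deriv (deriv c)) s := fun s hs => (hdca s hs).deriv
  -- the worldline: `ċ(s) = u(s, x₀ + c(s))` on `I`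
  have hflow : ∀ s ∈ I, deriv c s = u s (x₀ + c s) := by
    intro s hs
    have h1 : HasDerivAt c (uncurry u (s, Φ x₀ s)) s := by
      have h := (hΦd x₀ hx₀b s hs).1
      simpa [hc] using h.sub_const x₀
    rw [h1.deriv]; simp [hc]
  have hmemU : ∀ s ∈ I, ((s, x₀ + c s) : ℝ × EuclideanSpace ℝ (Fin 3)) ∈ U := by
    intro s hs
    have h := (hΦd x₀ hx₀b s hs).2
    simpa [hc] using h
  -- the translation and the boosted datum
  set τ : ℝ × EuclideanSpace ℝ (Fin 3) → ℝ × EuclideanSpace ℝ (Fin 3) := fun p => (p.1, p.2 + c p.1) with hτ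
  set u' : ℝ → EuclideanSpace ℝ (Fin 3) → EuclideanSpace ℝ (Fin 3) := fun s z => u s (z + c s) - deriv c s with hu'
  set μ' : ℝ → ℝ → ℝ := fun s ζ => μ s (ζ + c s 2) with hμ'
  set A' : ℝ → ℝ → ℝ := fun s ζ => A s (ζ + c s 2) +
      deriv c s 2 * (jetLetter (uncurry μ) (word2 1 0) (s, ζ + c s 2) -
        jetLetter (uncurry μ) (word2 0 2) (s, ζ + c s 2)) +
      deriv c s 2 ^ 2 / 2 * jetLetter (uncurry μ) (word2 0 1) (s, ζ + c s 2) -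
      (1 - μ s (ζ + c s 2)) * deriv (deriv c) s 2 with hA'
  set U' : Set (ℝ × EuclideanSpace ℝ (Fin 3)) := {p | p.1 ∈ I ∧ τ p ∈ U} with hU'
  have hτa : ∀ p : ℝ × EuclideanSpace ℝ (Fin 3), p.1 ∈ I → AnalyticAt ℝ τ p := fun p hp => by
    rw [hτ]
    exact analyticAt_fst.prod (analyticAt_snd.add ((hca p.1 hp).comp analyticAt_fst))
  have hτ2 : ∀ p : ℝ × EuclideanSpace ℝ (Fin 3), ((τ p).1, (τ p).2 2) = (p.1, p.2 2 + c p.1 2) := fun p => by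
    rw [hτ]; simp
  have hsha : ∀ q : ℝ × ℝ, q.1 ∈ I → AnalyticAt ℝ (fun q : ℝ × ℝ => ((q.1, q.2 + c q.1 2) : ℝ × ℝ)) q := by
    intro q hq
    have hc2 : AnalyticAt ℝ (fun s : ℝ => c s 2) q.1 := by
      have h := (EuclideanSpace.proj (2 : Fin 3) : EuclideanSpace ℝ (Fin 3) →L[ℝ] ℝ).analyticAt (c q.1)
      exact h.comp (hca q.1 hq)
    exact analyticAt_fst.prod (analyticAt_snd.add (hc2.comp analyticAt_fst))
  have hU'o : IsOpen U' := by
    rw [isOpen_iff_mem_nhds]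
    intro p hp
    have h1 : ∀ᶠ q in 𝓝 p, q.1 ∈ I := (hIo.preimage continuous_fst).mem_nhds hp.1
    have h2 : ∀ᶠ q in 𝓝 p, τ q ∈ U := (hτa p hp.1).continuousAt.preimage_mem_nhds (hU.mem_nhds hp.2)
    exact (h1.and h2).mono fun q hq => hq
  have hτ₀ : τ (t₀, x₀) = (t₀, x₀) := by rw [hτ]; simp [hc₀]
  have hp₀' : ((t₀, x₀) : ℝ × EuclideanSpace ℝ (Fin 3)) ∈ U' := by
    refine ⟨ht₀I, ?_⟩
    show τ (t₀, x₀) ∈ U; rw [hτ₀]; exact hp₀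
  -- analyticity of the boosted datum
  have hu'a : AnalyticOnNhd ℝ (uncurry u') U' := by
    intro p hp
    have hd : AnalyticAt ℝ (fun q : ℝ × EuclideanSpace ℝ (Fin 3) => deriv c q.1) p := (hdca p.1 hp.1).comp analyticAt_fst
    have h := ((hu (τ p) hp.2).comp (hτa p hp.1)).sub hd
    refine h.congr (Eventually.of_forall fun q => ?_)
    obtain ⟨s, z⟩ := q; rfl
  have hμ'a : ∀ p ∈ U', AnalyticAt ℝ (uncurry μ') (p.1, p.2 2) := by
    intro p hp
    have h1 : AnalyticAt ℝ (uncurry μ) (p.1, p.2 2 + c p.1 2) := by rw [← hτ2]; exact hμ (τ p) hp.2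
    have h := AnalyticAt.comp (f := fun q : ℝ × ℝ => ((q.1, q.2 + c q.1 2) : ℝ × ℝ)) (x := (p.1, p.2 2))
      h1 (hsha (p.1, p.2 2) hp.1)
    refine h.congr (Eventually.of_forall fun q => ?_)
    obtain ⟨s, ζ⟩ := q; rfl
  have hA'a : ∀ p ∈ U', AnalyticAt ℝ (uncurry A') (p.1, p.2 2) := by
    intro p hp
    have hm : ((p.1, p.2 2 + c p.1 2) : ℝ × ℝ) ∈ analyticSet μ := by
      show AnalyticAt ℝ (uncurry μ) _; rw [← hτ2]; exact hμ (τ p) hp.2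
    have hJ : ∀ w, AnalyticAt ℝ (fun q : ℝ × ℝ => jetLetter (uncurry μ) w (q.1, q.2 + c q.1 2)) (p.1, p.2 2) :=
      fun w => AnalyticAt.comp (f := fun q : ℝ × ℝ => ((q.1, q.2 + c q.1 2) : ℝ × ℝ)) (x := (p.1, p.2 2))
        (analyticOnNhd_jetLetter (analyticOnNhd_analyticSet μ) w _ hm) (hsha (p.1, p.2 2) hp.1)
    have hA1 : AnalyticAt ℝ (fun q : ℝ × ℝ => A q.1 (q.2 + c q.1 2)) (p.1, p.2 2) := by
      have h1 : AnalyticAt ℝ (uncurry A) (p.1, p.2 2 + c p.1 2) := by rw [← hτ2]; exact hA (τ p) hp.2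
      have h := AnalyticAt.comp (f := fun q : ℝ × ℝ => ((q.1, q.2 + c q.1 2) : ℝ × ℝ)) (x := (p.1, p.2 2))
        h1 (hsha (p.1, p.2 2) hp.1)
      refine h.congr (Eventually.of_forall fun q => ?_)
      obtain ⟨s, ζ⟩ := q; rfl
    have hM1 : AnalyticAt ℝ (fun q : ℝ × ℝ => μ q.1 (q.2 + c q.1 2)) (p.1, p.2 2) := by
      have h := (hJ (word2 0 0))
      refine h.congr (Eventually.of_forall fun q => ?_)
      simp [word2]
    have hfst : AnalyticAt ℝ (fun q : ℝ × ℝ => q.1) (p.1, p.2 2) := analyticAt_fst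
    have hd1 : AnalyticAt ℝ (fun q : ℝ × ℝ => deriv c q.1 2) (p.1, p.2 2) :=
      ((EuclideanSpace.proj (2 : Fin 3) : EuclideanSpace ℝ (Fin 3) →L[ℝ] ℝ).analyticAt _).comp ((hdca p.1 hp.1).comp_of_eq hfst rfl)
    have hd2 : AnalyticAt ℝ (fun q : ℝ × ℝ => deriv (deriv c) q.1 2) (p.1, p.2 2) :=
      ((EuclideanSpace.proj (2 : Fin 3) : EuclideanSpace ℝ (Fin 3) →L[ℝ] ℝ).analyticAt _).comp ((hddca p.1 hp.1).comp_of_eq hfst rfl)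
    have h := ((hA1.add (hd1.mul ((hJ (word2 1 0)).sub (hJ (word2 0 2))))).add
      (((hd1.pow 2).div_const (c := (2 : ℝ))).mul (hJ (word2 0 1)))).sub (((analyticAt_const (v := (1 : ℝ))).sub hM1).mul hd2)
    refine h.congr (Eventually.of_forall fun q => ?_)
    obtain ⟨s, ζ⟩ := q; rfl
  -- the kinematic identities transfer pointwise through the translated jets
  have hent : ∀ p : ℝ × EuclideanSpace ℝ (Fin 3), ∀ e : EuclideanSpace ℝ (Fin 3), ∀ i : Fin 3,
      fderiv ℝ (u' p.1) p.2 e i = fderiv ℝ (u (τ p).1) (τ p).2 e i := fun p e i => by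
    rw [hu', hτ]; dsimp only; rw [fderiv_tboost]
  have hslope : ∀ p : ℝ × EuclideanSpace ℝ (Fin 3), μ' p.1 (p.2 2) = μ (τ p).1 ((τ p).2 2) := fun p => by
    rw [hμ', hτ]; simp
  have hpol' : ∀ p ∈ U', fderiv ℝ (u' p.1) p.2 (EuclideanSpace.single 0 1) 1 =
      fderiv ℝ (u' p.1) p.2 (EuclideanSpace.single 1 1) 0 := fun p hp => by
    rw [hent, hent]; exact hpol (τ p) hp.2
  have hdiv' : ∀ p ∈ U', fderiv ℝ (u' p.1) p.2 (EuclideanSpace.single 0 1) 0 +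
      fderiv ℝ (u' p.1) p.2 (EuclideanSpace.single 1 1) 1 + fderiv ℝ (u' p.1) p.2 (EuclideanSpace.single 2 1) 2 = 0 :=
    fun p hp => by rw [hent, hent, hent]; exact hdiv (τ p) hp.2
  have hsh' : ∀ p ∈ U', ∀ b : Fin 3, b ≠ 2 → fderiv ℝ (u' p.1) p.2 (EuclideanSpace.single 2 1) b =
      μ' p.1 (p.2 2) * fderiv ℝ (u' p.1) p.2 (EuclideanSpace.single b 1) 2 := fun p hp b hb => by
    rw [hent, hent, hslope]; exact hsh (τ p) hp.2 b hb
  -- the scalar law transfers by covariance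
  have hE' : ∀ p ∈ U',
      (1 - μ' p.1 (p.2 2)) *
          (deriv (fun s => u' s p.2 2) p.1 + fderiv ℝ (fun y => u' p.1 y 2) p.2 (u' p.1 p.2)
            - Δ (fun y => u' p.1 y 2) p.2) =
        A' p.1 (p.2 2) + (deriv (fun s => μ' s (p.2 2)) p.1 - deriv (deriv (μ' p.1)) (p.2 2)) * u' p.1 p.2 2
          + deriv (μ' p.1) (p.2 2) / 2 * u' p.1 p.2 2 ^ 2
          - 2 * deriv (μ' p.1) (p.2 2) * fderiv ℝ (u' p.1) p.2 (EuclideanSpace.single 2 1) 2 := by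
    intro p hp
    obtain ⟨t, y⟩ := p
    have htI : t ∈ I := hp.1
    have hq : ((t, y + c t) : ℝ × EuclideanSpace ℝ (Fin 3)) ∈ U := hp.2
    have hEq := hE _ hq
    dsimp only at hEq
    have h10 := letterFn_M10 (u := u) (A := A) hμ hq
    have h01 := letterFn_M01 (u := u) (A := A) hμ hq
    have h02 := letterFn_M02 (u := u) (A := A) hμ hq
    have e2 : (y + c t) 2 = y 2 + c t 2 := by simp
    simp only [letterFn, e2] at h10 h01 h02
    have hG := comoving_E (A := A) hu hμ c (hca t htI).differentiableAt (hdca t htI).differentiableAt hq hEq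
    rw [hu', hμ', hA']
    dsimp only
    rw [h10, h01, h02]
    exact hG
  -- the pins at `p₀` are unchanged, `u′(p₀) = 0`, and the worldline rests
  have hent₀ : ∀ e : EuclideanSpace ℝ (Fin 3), ∀ i : Fin 3, fderiv ℝ (u' t₀) x₀ e i = fderiv ℝ (u t₀) x₀ e i :=
    fun e i => by have h := hent (t₀, x₀) e i; rwa [hτ₀] at h
  have hent2₀ : ∀ e : EuclideanSpace ℝ (Fin 3),
      fderiv ℝ (fun y => fderiv ℝ (u' t₀) y (EuclideanSpace.single 2 1) 2) x₀ e =
        fderiv ℝ (fun y => fderiv ℝ (u t₀) y (EuclideanSpace.single 2 1) 2) x₀ e := fun e => by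
    rw [hu']; dsimp only; rw [fderiv_fderiv_tboost]; simp [hc₀]
  have hsl₀ : μ' t₀ (x₀ 2) = μ t₀ (x₀ 2) := by rw [hμ']; simp [hc₀]
  have hslz₀ : deriv (μ' t₀) (x₀ 2) = deriv (μ t₀) (x₀ 2) := by
    rw [hμ']; dsimp only; rw [deriv_comp_add_const (μ t₀) (c t₀ 2) (x₀ 2)]; simp [hc₀]
  have hdc₀ : deriv c t₀ = 0 := by rw [hflow t₀ ht₀I, hc₀, add_zero]; exact hrest
  have hrest' : u' t₀ x₀ = 0 := by rw [hu']; simp [hc₀, hdc₀, hrest]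
  have hline : ∀ᶠ s in 𝓝 t₀, u' s x₀ = 0 := by
    filter_upwards [hIo.mem_nhds ht₀I] with s hs
    rw [hu']; dsimp only; rw [hflow s hs]; simp
  refine hC u' μ' A' U' (t₀, x₀) hU'o hp₀' hu'a hμ'a hA'a hpol' hdiv' hsh' hE' ?_ ?_ ?_ ?_ ?_ ?_ hrest' ?_ ?_ hline
  · simp only [hent₀, hent2₀]; exact htw
  · simp only [hsl₀]; exact hm0
  · simp only [hsl₀]; exact hm1
  · simp only [hslz₀]; exact hmz
  · simp only [hsl₀]; exact hneg
  · simp only [hent₀]; exact hNU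
  · simp only [hent₀]; exact hx0
  · simp only [hent₀]; exact hy1

end Summit.NavierStokesRegularity.NavierStokesRegularity.Theorems.PoloidalWindowDoorLrcModEntireTwistingTHLocalComoving

end
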